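import Mathlib
import HarnessLib
import Summits.HubbardSuperconductivity.HubbardSuperconductivity.Theorems.KLProgrammePerturbedFermiCurveSlopeNormalForm
import Summits.HubbardSuperconductivity.HubbardSuperconductivity.Theorems.KLProgrammePerturbedFermiCurveGaussMapHalfTorus
import Summits.HubbardSuperconductivity.HubbardSuperconductivity.Theorems.KLProgrammePolarRayCoareaFrame
import Summits.HubbardSuperconductivity.HubbardSuperconductivity.Theorems.KLProgrammeKLRegimeTwoPointLimitShellCountCooper

/-!
# Route `KLProgramme` — ENGINE child (stmt-HubbardSuperconductivity-20437 `KLRegimeEngineV17F2`): the normal angle of the frame's level curves is LIPSCHITZ IN THE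
# LEVEL (mod π, via `‖D²e_K‖ ≤ Kc` of `FrameOK` (i)), and the complete pointwise ANGLE ALTERNATIVE of step (T1) of the `TwoShellFrameAreaAt` witness
# (design note HOME/hubbard-kl-k3c2-p2/TWO-SHELL-FRAME-PORT.md §3)

Cell `gate-hubbard-kl`, seat hubbard-kl-k3c2-p2 g15; companion of `…SlopeNormalForm` / `…GaussMapHalfTorus` / `…AngleAlternative`.  Two root selections
`u₁` (level `ν₁`) and `u₂` (level `ν₂`) of the same frame `δ_K = −K.eval` have, at the SAME angle `φ`, coordinate gradients `g_i = Λ_i·dir α_i`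
(`slopeForm_eq_radial_mul`, `Λ_i ≥ Dt_min − κ₁`) at the two points `u_i(φ)·dir φ` of the same ray, `|u₁(φ) − u₂(φ)| ≤ |ν₁ − ν₂|/(Dt_min − κ₁)`
(`klrf_level_lipschitz`), and `‖De_K(P₁) − De_K(P₂)‖ ≤ Kc·|u₁ − u₂|` (mean value theorem with `‖D²e_K‖ ≤ Kc` from `GeomConstants`).  Hence:
* §1 `mul_abs_sin_sub_le_of_polar` — planar: `Λ₂·|sin(α₁ − α₂)| ≤ |Δg₀| + |Δg₁|` for `g_i = Λ_i·dir α_i`, `Λ₁ > 0`;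
* §2 **`abs_sin_normalAngle_sub_le_of_geomConstants`** — `|sin(α₁(φ) − α₂(φ))| ≤ 2Kc·|u₁(φ) − u₂(φ)|/(Dt_min − κ₁)`, and with the level Lipschitz bound
  **`abs_sin_normalAngle_sub_le_level`** — `≤ 2Kc·|ν₁ − ν₂|/(Dt_min − κ₁)²` (no smallness needed; N-uniform: only `κ₀`, `κ₁`, `Kc`);
* §3 **`angle_alternative_sin_of_geomConstants`** — `c_K·min(‖φ − θ‖_𝕋, ‖φ − θ − π‖_𝕋) ≤ (π/2)·|ℓ|/((Dt_min − κ₁)u_min) + (π/2)·|sin(α₁(φ) − α₂(φ))|`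
  and the LEVEL form **`angle_alternative_level_of_geomConstants`**: `… ≤ (π/2)·|ℓ|/((Dt_min − κ₁)u_min) + π·Kc·|ν₁ − ν₂|/(Dt_min − κ₁)²` —
  «slope `≤ λ` at `(φ, θ)` between two thin-shell level curves ⇒ `θ ≡ φ` (Cooper) or `θ ≡ φ + π` (caustic) up to `O(λ + |ν₁ − ν₂|)`».
Everything is PROVED; no definitions, no named facts; nothing asserts any stub or superconductivity.
References: BGM 2003 §7.1 Lemma 7.1 [cite: BenfattoGiulianiMastropietro2003]; FST II Lemma 2.1, App. B [cite: FeldmanSalmhoferTrubowitz1998].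
-/

noncomputable section

namespace Summit.HubbardSuperconductivity.HubbardSuperconductivity.Theorems.PerturbedFermiCurve

set_option linter.dupNamespace false -- summit = problem name (single-conjunct summit), D-0017

open Real Set
open Literature.MathematicalPhysics.QuantumLattice Literature.MathematicalPhysics.QuantumLattice.BandSectorCounting
open Literature.MathematicalPhysics.QuantumLattice.FermiRG
open Summit.HubbardSuperconductivity.HubbardSuperconductivity.Theorems.DispersionFlow
open Summit.HubbardSuperconductivity.HubbardSuperconductivity.Theorems.KLRegimeSplit

/-! ## §1 Planar: the angle of two vectors from their difference -/

/-- **`Λ₂·|sin(α₁ − α₂)| ≤ |Δg₀| + |Δg₁|`** for `g_i = Λ_i·(cos α_i, sin α_i)`, `Λ₁ > 0` (the cross product `g₁ × g₂ = g₁ × (g₂ − g₁)`). [folklore] -/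
theorem mul_abs_sin_sub_le_of_polar {Λ₁ Λ₂ α₁ α₂ : ℝ} (hΛ₁ : 0 < Λ₁) :
    Λ₂ * |Real.sin (α₁ - α₂)| ≤
      |Λ₂ * Real.cos α₂ - Λ₁ * Real.cos α₁| + |Λ₂ * Real.sin α₂ - Λ₁ * Real.sin α₁| := by
  set d0 := Λ₂ * Real.cos α₂ - Λ₁ * Real.cos α₁ with hd0
  set d1 := Λ₂ * Real.sin α₂ - Λ₁ * Real.sin α₁ with hd1
  -- cross product two ways
  have hcross : Λ₁ * (Λ₂ * Real.sin (α₂ - α₁)) = Λ₁ * (Real.cos α₁ * d1 - Real.sin α₁ * d0) := by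
    rw [Real.sin_sub, hd0, hd1]; ring
  have hc : Λ₂ * Real.sin (α₂ - α₁) = Real.cos α₁ * d1 - Real.sin α₁ * d0 := mul_left_cancel₀ hΛ₁.ne' hcross
  have hsym : |Real.sin (α₁ - α₂)| = |Real.sin (α₂ - α₁)| := by
    rw [← neg_sub α₂ α₁, Real.sin_neg, abs_neg]
  have hΛ₂abs : Λ₂ * |Real.sin (α₁ - α₂)| ≤ |Λ₂ * Real.sin (α₂ - α₁)| := by
    rw [hsym, abs_mul]
    exact mul_le_mul_of_nonneg_right (le_abs_self _) (abs_nonneg _)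
  refine hΛ₂abs.trans ?_
  rw [hc]
  calc |Real.cos α₁ * d1 - Real.sin α₁ * d0| ≤ |Real.cos α₁ * d1| + |Real.sin α₁ * d0| := abs_sub _ _
    _ ≤ |d1| + |d0| := by
        rw [abs_mul, abs_mul]
        exact add_le_add (mul_le_of_le_one_left (abs_nonneg _) (Real.abs_cos_le_one _))
          (mul_le_of_le_one_left (abs_nonneg _) (Real.abs_sin_le_one _))
    _ = |d0| + |d1| := add_comm _ _

/-! ## §2 The normal angle is Lipschitz in the level (mod π) -/

/-- **The gradient moves by `≤ Kc·|u₁ − u₂|` along a ray**: `|ℓ_{P₁}(v) − ℓ_{P₂}(v)| ≤ Kc·|u₁(φ) − u₂(φ)|` for `v = e₀, e₁` (mean value theorem for `De_K` with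
`‖D²e_K‖ ≤ Kc`; `ℓ_P(v) = De_K(toLp P)[toLp v]`). [cite: FeldmanSalmhoferTrubowitz1998, Lemma 2.1] -/
theorem abs_slopeForm_sub_slopeForm_le {μ : ℝ} {K : TrigPolyC4v} {Kc r₀ g₀ w : ℝ} (hG : GeomConstants (frameLevel μ K) Kc r₀ g₀ w)
    (u₁ u₂ : ℝ → ℝ) (φ : ℝ) (v : Fin 2 → ℝ) (hv : ‖(WithLp.toLp 2 v : Momentum)‖ ≤ 1) :
    |(2 * Real.sin (XE u₁ φ) * v 0 + 2 * Real.sin (YE u₁ φ) * v 1 + fderiv ℝ (fun k : Fin 2 → ℝ => -K.eval k) (u₁ φ • dir φ) v) -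
        (2 * Real.sin (XE u₂ φ) * v 0 + 2 * Real.sin (YE u₂ φ) * v 1 + fderiv ℝ (fun k : Fin 2 → ℝ => -K.eval k) (u₂ φ • dir φ) v)| ≤
      Kc * |u₁ φ - u₂ φ| := by
  have hP : ∀ (u : ℝ → ℝ), 2 * Real.sin (XE u φ) * v 0 + 2 * Real.sin (YE u φ) * v 1 +
      fderiv ℝ (fun k : Fin 2 → ℝ => -K.eval k) (u φ • dir φ) v = fderiv ℝ (frameLevel μ K) (WithLp.toLp 2 (u φ • dir φ)) (WithLp.toLp 2 v) := by
    intro u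
    rw [fderiv_frameLevel_toLp]
    simp [XE, YE, dir]
  rw [hP u₁, hP u₂, ← sub_apply]
  -- mean value theorem for `De_K`
  have hcd : ContDiff ℝ 2 (frameLevel μ K) := by
    rw [frameLevel_eq_add]; exact (klfs_contDiff_e μ).add (contDiff_frameShift K)
  have hd1 : ContDiff ℝ 1 (fderiv ℝ (frameLevel μ K)) := hcd.fderiv_right (by norm_num)
  have hdiff : ∀ x ∈ (Set.univ : Set Momentum), DifferentiableAt ℝ (fderiv ℝ (frameLevel μ K)) x :=
    fun x _ => (hd1.differentiable one_ne_zero) x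
  have hbound : ∀ x ∈ (Set.univ : Set Momentum), ‖fderiv ℝ (fderiv ℝ (frameLevel μ K)) x‖ ≤ Kc := by
    intro x _
    rw [← norm_iteratedFDeriv_one (𝕜 := ℝ) (f := fderiv ℝ (frameLevel μ K)), norm_iteratedFDeriv_fderiv]
    exact hG.norm_iteratedFDeriv_le x 2 le_rfl
  have hmvt := convex_univ.norm_image_sub_le_of_norm_fderiv_le hdiff hbound (Set.mem_univ (WithLp.toLp 2 (u₂ φ • dir φ)))
    (Set.mem_univ (WithLp.toLp 2 (u₁ φ • dir φ)))
  have hdist : ‖(WithLp.toLp 2 (u₁ φ • dir φ) : Momentum) - WithLp.toLp 2 (u₂ φ • dir φ)‖ = |u₁ φ - u₂ φ| := by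
    rw [← WithLp.toLp_sub, ← sub_smul, EuclideanSpace.norm_eq, Fin.sum_univ_two]
    simp only [Pi.smul_apply, smul_eq_mul, Real.norm_eq_abs, dir_zero, dir_one]
    have h : |(u₁ φ - u₂ φ) * Real.cos φ| ^ 2 + |(u₁ φ - u₂ φ) * Real.sin φ| ^ 2 = (u₁ φ - u₂ φ) ^ 2 := by
      rw [sq_abs, sq_abs]; nlinarith [Real.cos_sq_add_sin_sq φ]
    rw [h, Real.sqrt_sq_eq_abs]
  rw [hdist] at hmvt
  have hKc : 0 ≤ Kc := le_trans (norm_nonneg _) (hG.norm_iteratedFDeriv_le (WithLp.toLp 2 v) 0 (by norm_num))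
  rw [← Real.norm_eq_abs]
  calc _ ≤ ‖fderiv ℝ (frameLevel μ K) (WithLp.toLp 2 (u₁ φ • dir φ)) - fderiv ℝ (frameLevel μ K) (WithLp.toLp 2 (u₂ φ • dir φ))‖ *
        ‖(WithLp.toLp 2 v : Momentum)‖ := ContinuousLinearMap.le_opNorm _ _
    _ ≤ Kc * |u₁ φ - u₂ φ| * 1 := mul_le_mul hmvt hv (norm_nonneg _) (mul_nonneg hKc (abs_nonneg _))
    _ = Kc * |u₁ φ - u₂ φ| := mul_one _

section Frame

variable {a b : ℝ} (B : BandBounds a b) {K : TrigPolyC4v} {κ₀ κ₁ : ℝ}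
  (hδ : ∀ k : Fin 2 → ℝ, (∀ i, |k i| ≤ π) → |(fun k : Fin 2 → ℝ => -K.eval k) k| ≤ κ₀)
  (hκ : ∀ k : Fin 2 → ℝ, (∀ i, |k i| ≤ π) → ‖fderiv ℝ (fun k : Fin 2 → ℝ => -K.eval k) k‖ ≤ κ₁) (hκ₁ : κ₁ < B.Dtmin)
  {μ Kc r₀ g₀ w : ℝ} (hG : GeomConstants (frameLevel μ K) Kc r₀ g₀ w)
  {ν₁ : ℝ} (hlo₁ : a ≤ ν₁ - κ₀) (hhi₁ : ν₁ + κ₀ ≤ b) {u₁ : ℝ → ℝ}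
  (hu₁ : ∀ θ, IsBandFermiRadius (ν₁ - (fun k : Fin 2 → ℝ => -K.eval k) (u₁ θ • dir θ)) θ (u₁ θ))
  {ν₂ : ℝ} (hlo₂ : a ≤ ν₂ - κ₀) (hhi₂ : ν₂ + κ₀ ≤ b) {u₂ : ℝ → ℝ}
  (hu₂ : ∀ θ, IsBandFermiRadius (ν₂ - (fun k : Fin 2 → ℝ => -K.eval k) (u₂ θ • dir θ)) θ (u₂ θ))
include B hδ hκ hκ₁ hG hlo₁ hhi₁ hu₁ hlo₂ hhi₂ hu₂

/-- **`|sin(α₁(φ) − α₂(φ))| ≤ 2Kc·|u₁(φ) − u₂(φ)|/(Dt_min − κ₁)`** — the normal angles of two level curves at the same ray angle differ (mod π) by the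
gradient displacement over the radial gradient. [cite: BenfattoGiulianiMastropietro2003, §7.1 Lemma 7.1] -/
theorem abs_sin_normalAngle_sub_le_of_geomConstants (φ : ℝ) :
    |Real.sin ((φ - Real.arctan (deriv u₁ φ / u₁ φ)) - (φ - Real.arctan (deriv u₂ φ / u₂ φ)))| ≤
      2 * Kc * |u₁ φ - u₂ φ| / (B.Dtmin - κ₁) := by
  have hδs : ContDiff ℝ 2 (fun k : Fin 2 → ℝ => -K.eval k) := contDiff_frameShift_toLp K
  have h2ne : (2 : WithTop ℕ∞) ≠ 0 := by norm_num
  have hu2₁ : ContDiff ℝ 2 u₁ := contDiff_of_isRoot B hδs h2ne hδ hlo₁ hhi₁ hκ hκ₁ hu₁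
  have hu2₂ : ContDiff ℝ 2 u₂ := contDiff_of_isRoot B hδs h2ne hδ hlo₂ hhi₂ hκ hκ₁ hu₂
  have hroot₁ : ∀ ϑ, sqDispersion (u₁ ϑ • dir ϑ) + (fun k : Fin 2 → ℝ => -K.eval k) (u₁ ϑ • dir ϑ) = ν₁ := fun ϑ =>
    ((isBandFermiRadius_shifted_iff (fun k : Fin 2 → ℝ => -K.eval k) ν₁ ϑ (u₁ ϑ)).1 (hu₁ ϑ)).2
  have hroot₂ : ∀ ϑ, sqDispersion (u₂ ϑ • dir ϑ) + (fun k : Fin 2 → ℝ => -K.eval k) (u₂ ϑ • dir ϑ) = ν₂ := fun ϑ =>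
    ((isBandFermiRadius_shifted_iff (fun k : Fin 2 → ℝ => -K.eval k) ν₂ ϑ (u₂ ϑ)).1 (hu₂ ϑ)).2
  have hpos₁ : ∀ ϑ, 0 < u₁ ϑ := fun ϑ => (mem_Ioo_of_shifted B hδ hlo₁ hhi₁ (hu₁ ϑ)).1
  have hpos₂ : ∀ ϑ, 0 < u₂ ϑ := fun ϑ => (mem_Ioo_of_shifted B hδ hlo₂ hhi₂ (hu₂ ϑ)).1
  -- the two gradients in polar form
  set α₁ := φ - Real.arctan (deriv u₁ φ / u₁ φ) with hα₁
  set α₂ := φ - Real.arctan (deriv u₂ φ / u₂ φ) with hα₂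
  set Λ₁ := (rayDispersionDt φ (u₁ φ) + fderiv ℝ (fun k : Fin 2 → ℝ => -K.eval k) (u₁ φ • dir φ) (dir φ)) *
      Real.sqrt (u₁ φ ^ 2 + deriv u₁ φ ^ 2) / u₁ φ with hΛ₁
  set Λ₂ := (rayDispersionDt φ (u₂ φ) + fderiv ℝ (fun k : Fin 2 → ℝ => -K.eval k) (u₂ φ • dir φ) (dir φ)) *
      Real.sqrt (u₂ φ ^ 2 + deriv u₂ φ ^ 2) / u₂ φ with hΛ₂
  have hg₁ := fun v => slopeForm_eq_radial_mul hδs hu2₁ hroot₁ hpos₁ φ v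
  have hg₂ := fun v => slopeForm_eq_radial_mul hδs hu2₂ hroot₂ hpos₂ φ v
  -- the radial factors are `≥ Dt_min − κ₁ > 0`
  have hρ₁ := Dtmin_sub_le_pertDt B hδ hlo₁ hhi₁ hκ hu₁ φ
  have hρ₂ := Dtmin_sub_le_pertDt B hδ hlo₂ hhi₂ hκ hu₂ φ
  have hD : 0 < B.Dtmin - κ₁ := sub_pos.2 hκ₁
  have hsu : ∀ {u : ℝ → ℝ}, 0 < u φ → 1 ≤ Real.sqrt (u φ ^ 2 + deriv u φ ^ 2) / u φ := by
    intro u hu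
    rw [le_div_iff₀ hu, one_mul]
    calc u φ = Real.sqrt (u φ ^ 2) := (Real.sqrt_sq hu.le).symm
      _ ≤ _ := Real.sqrt_le_sqrt (by nlinarith [sq_nonneg (deriv u φ)])
  have hΛ₁ge : B.Dtmin - κ₁ ≤ Λ₁ := by
    rw [hΛ₁, mul_div_assoc]
    calc B.Dtmin - κ₁ = (B.Dtmin - κ₁) * 1 := (mul_one _).symm
      _ ≤ _ := mul_le_mul hρ₁ (hsu (hpos₁ φ)) zero_le_one (hD.le.trans hρ₁)
  have hΛ₂ge : B.Dtmin - κ₁ ≤ Λ₂ := by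
    rw [hΛ₂, mul_div_assoc]
    calc B.Dtmin - κ₁ = (B.Dtmin - κ₁) * 1 := (mul_one _).symm
      _ ≤ _ := mul_le_mul hρ₂ (hsu (hpos₂ φ)) zero_le_one (hD.le.trans hρ₂)
  have hΛ₁pos : 0 < Λ₁ := hD.trans_le hΛ₁ge
  -- the coordinate differences are `≤ Kc·|Δu|`
  have he₀ : ‖(WithLp.toLp 2 (![1, 0] : Fin 2 → ℝ) : Momentum)‖ ≤ 1 := by
    rw [EuclideanSpace.norm_eq, Fin.sum_univ_two]; simp
  have he₁ : ‖(WithLp.toLp 2 (![0, 1] : Fin 2 → ℝ) : Momentum)‖ ≤ 1 := by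
    rw [EuclideanSpace.norm_eq, Fin.sum_univ_two]; simp
  have hd₀ := abs_slopeForm_sub_slopeForm_le hG u₁ u₂ φ ![1, 0] he₀
  have hd₁ := abs_slopeForm_sub_slopeForm_le hG u₁ u₂ φ ![0, 1] he₁
  rw [hg₁, hg₂] at hd₀ hd₁
  simp only [Matrix.cons_val_zero, Matrix.cons_val_one, Fin.isValue, mul_one, mul_zero, add_zero, zero_add] at hd₀ hd₁
  rw [← hΛ₁, ← hΛ₂] at hd₀ hd₁
  -- planar lemma
  have hplanar := mul_abs_sin_sub_le_of_polar (Λ₂ := Λ₂) (α₁ := α₁) (α₂ := α₂) hΛ₁pos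
  have hsum : |Λ₂ * Real.cos α₂ - Λ₁ * Real.cos α₁| + |Λ₂ * Real.sin α₂ - Λ₁ * Real.sin α₁| ≤ 2 * Kc * |u₁ φ - u₂ φ| := by
    rw [abs_sub_comm (Λ₂ * Real.cos α₂), abs_sub_comm (Λ₂ * Real.sin α₂)]
    linarith
  rw [le_div_iff₀ hD]
  calc |Real.sin (α₁ - α₂)| * (B.Dtmin - κ₁) ≤ |Real.sin (α₁ - α₂)| * Λ₂ := mul_le_mul_of_nonneg_left hΛ₂ge (abs_nonneg _)
    _ = Λ₂ * |Real.sin (α₁ - α₂)| := mul_comm _ _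
    _ ≤ 2 * Kc * |u₁ φ - u₂ φ| := hplanar.trans hsum

/-- **Level form**: `|sin(α₁(φ) − α₂(φ))| ≤ 2Kc·|ν₁ − ν₂|/(Dt_min − κ₁)²` for the CANONICAL root selections `u_i = perturbedFermiRadius δ_K ν_i`
(`klrf_level_lipschitz`). [cite: BenfattoGiulianiMastropietro2003, §7.1 Lemma 7.1] -/
theorem abs_sin_normalAngle_sub_le_level
    (h₁ : u₁ = perturbedFermiRadius (fun k : Fin 2 → ℝ => -K.eval k) ν₁) (h₂ : u₂ = perturbedFermiRadius (fun k : Fin 2 → ℝ => -K.eval k) ν₂)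
    (φ : ℝ) :
    |Real.sin ((φ - Real.arctan (deriv u₁ φ / u₁ φ)) - (φ - Real.arctan (deriv u₂ φ / u₂ φ)))| ≤
      2 * Kc * |ν₁ - ν₂| / (B.Dtmin - κ₁) ^ 2 := by
  have h := abs_sin_normalAngle_sub_le_of_geomConstants B hδ hκ hκ₁ hG hlo₁ hhi₁ hu₁ hlo₂ hhi₂ hu₂ φ
  have hD : 0 < B.Dtmin - κ₁ := sub_pos.2 hκ₁
  have hKc : 0 ≤ Kc := le_trans (norm_nonneg _) (hG.norm_iteratedFDeriv_le 0 0 (by norm_num))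
  have hδ1 : ContDiff ℝ 1 (fun k : Fin 2 → ℝ => -K.eval k) := contDiff_frameShift_toLp K
  have hlev : |u₁ φ - u₂ φ| ≤ |ν₁ - ν₂| / (B.Dtmin - κ₁) := by
    rw [h₁, h₂]; exact klrf_level_lipschitz B hδ1 hδ hκ hκ₁ hlo₂ hhi₂ hlo₁ hhi₁ φ
  refine h.trans ?_
  rw [div_le_div_iff₀ hD (pow_pos hD 2)]
  have := mul_le_mul_of_nonneg_left hlev (by positivity : 0 ≤ 2 * Kc)
  calc 2 * Kc * |u₁ φ - u₂ φ| * (B.Dtmin - κ₁) ^ 2 ≤ 2 * Kc * (|ν₁ - ν₂| / (B.Dtmin - κ₁)) * (B.Dtmin - κ₁) ^ 2 :=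
        mul_le_mul_of_nonneg_right this (by positivity)
    _ = 2 * Kc * |ν₁ - ν₂| * (B.Dtmin - κ₁) := by field_simp
    _ = _ := by ring

/-! ## §3 The angle alternative in `sin` / level form -/

/-- **Angle alternative, `sin` form**: `c_K·min(‖φ − θ‖_𝕋, ‖φ − θ − π‖_𝕋) ≤ (π/2)·|ℓ|/((Dt_min − κ₁)·u_min) + (π/2)·|sin(α₁(φ) − α₂(φ))|` for a `π`-periodic `u₂`
with `|ν₂ − μ| < r₀` (`c_K = u_min·w/(4 + κ₁)`; no smallness on the angle discrepancy). [cite: BenfattoGiulianiMastropietro2003, §7.1 Lemma 7.1 (A1.9)] -/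
theorem angle_alternative_sin_of_geomConstants (hper₂ : Function.Periodic u₂ π) (hν₂ : |ν₂ - μ| < r₀) (φ θ : ℝ) :
    B.umin * w / (4 + κ₁) * min (torusDist (φ - θ)) (torusDist (φ - θ - π)) ≤
      π / 2 * |2 * Real.sin (XE u₁ φ) * VXE u₂ θ + 2 * Real.sin (YE u₁ φ) * VYE u₂ θ +
          fderiv ℝ (fun k : Fin 2 → ℝ => -K.eval k) (u₁ φ • dir φ) ![VXE u₂ θ, VYE u₂ θ]| / ((B.Dtmin - κ₁) * B.umin) +
        π / 2 * |Real.sin ((φ - Real.arctan (deriv u₁ φ / u₁ φ)) - (φ - Real.arctan (deriv u₂ φ / u₂ φ)))| := by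
  have hδs : ContDiff ℝ 2 (fun k : Fin 2 → ℝ => -K.eval k) := contDiff_frameShift_toLp K
  set ℓ := 2 * Real.sin (XE u₁ φ) * VXE u₂ θ + 2 * Real.sin (YE u₁ φ) * VYE u₂ θ +
      fderiv ℝ (fun k : Fin 2 → ℝ => -K.eval k) (u₁ φ • dir φ) ![VXE u₂ θ, VYE u₂ θ] with hℓ
  set x := (φ - Real.arctan (deriv u₁ φ / u₁ φ)) - (θ - Real.arctan (deriv u₂ θ / u₂ θ)) with hx
  set y := (φ - Real.arctan (deriv u₁ φ / u₁ φ)) - (φ - Real.arctan (deriv u₂ φ / u₂ φ)) with hy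
  have hD : 0 < (B.Dtmin - κ₁) * B.umin := mul_pos (sub_pos.2 hκ₁) B.umin_pos
  have hu₂min : B.umin ≤ u₂ θ := umin_le_of_shifted B hδ hlo₂ hhi₂ (hu₂ θ)
  have hslope : (B.Dtmin - κ₁) * B.umin * |Real.sin x| ≤ |ℓ| :=
    abs_slopeForm_tangent_ge B hδs hδ hlo₁ hhi₁ hκ hκ₁ hu₁ φ θ hu₂min
  have hsin : |Real.sin x| ≤ |ℓ| / ((B.Dtmin - κ₁) * B.umin) := by
    rw [le_div_iff₀ hD]; linarith
  obtain ⟨k, hk⟩ := klcc_exists_int_abs_sub_mul_pi_le x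
  obtain ⟨k', hk'⟩ := klcc_exists_int_abs_sub_mul_pi_le y
  have hexp := normalAngleFn_halfTorus_ge_of_geomConstants B hδ hlo₂ hhi₂ hκ hκ₁ hG hν₂ hu₂ hper₂ φ θ (k - k')
  have htri : |(φ - Real.arctan (deriv u₂ φ / u₂ φ)) - (θ - Real.arctan (deriv u₂ θ / u₂ θ)) - ((k - k' : ℤ) : ℝ) * π| ≤
      |x - k * π| + |y - k' * π| := by
    have e : (φ - Real.arctan (deriv u₂ φ / u₂ φ)) - (θ - Real.arctan (deriv u₂ θ / u₂ θ)) - ((k - k' : ℤ) : ℝ) * π =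
        (x - k * π) - (y - k' * π) := by rw [hx, hy]; push_cast; ring
    rw [e]; exact abs_sub _ _
  have hkπ : |x - k * π| ≤ π / 2 * |ℓ| / ((B.Dtmin - κ₁) * B.umin) := by
    calc |x - k * π| ≤ π / 2 * |Real.sin x| := hk
      _ ≤ π / 2 * (|ℓ| / ((B.Dtmin - κ₁) * B.umin)) := mul_le_mul_of_nonneg_left hsin (by positivity)
      _ = π / 2 * |ℓ| / ((B.Dtmin - κ₁) * B.umin) := by ring
  linarith

/-- **Angle alternative, LEVEL form** (canonical root selections `u_i = perturbedFermiRadius δ_K ν_i`, `u₂` is then `π`-periodic):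
`c_K·min(‖φ − θ‖_𝕋, ‖φ − θ − π‖_𝕋) ≤ (π/2)·|ℓ|/((Dt_min − κ₁)·u_min) + π·Kc·|ν₁ − ν₂|/(Dt_min − κ₁)²` — the crossing slope between two thin-shell level
curves of an admissible frame is small ONLY near `θ ≡ φ` (Cooper) or `θ ≡ φ + π` (caustic). [cite: BenfattoGiulianiMastropietro2003, §7.1 Lemma 7.1 (A1.9)] -/
theorem angle_alternative_level_of_geomConstants
    (h₁ : u₁ = perturbedFermiRadius (fun k : Fin 2 → ℝ => -K.eval k) ν₁) (h₂ : u₂ = perturbedFermiRadius (fun k : Fin 2 → ℝ => -K.eval k) ν₂)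
    (hν₂ : |ν₂ - μ| < r₀) (φ θ : ℝ) :
    B.umin * w / (4 + κ₁) * min (torusDist (φ - θ)) (torusDist (φ - θ - π)) ≤
      π / 2 * |2 * Real.sin (XE u₁ φ) * VXE u₂ θ + 2 * Real.sin (YE u₁ φ) * VYE u₂ θ +
          fderiv ℝ (fun k : Fin 2 → ℝ => -K.eval k) (u₁ φ • dir φ) ![VXE u₂ θ, VYE u₂ θ]| / ((B.Dtmin - κ₁) * B.umin) +
        π * Kc * |ν₁ - ν₂| / (B.Dtmin - κ₁) ^ 2 := by
  have heven : ∀ k : Fin 2 → ℝ, (fun k : Fin 2 → ℝ => -K.eval k) (-k) = (fun k : Fin 2 → ℝ => -K.eval k) k := fun k => by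
    simp only [TrigPolyC4v.eval_neg]
  have hper₂ : Function.Periodic u₂ π := by rw [h₂]; exact fun θ => perturbedFermiRadius_add_pi heven ν₂ θ
  have h := angle_alternative_sin_of_geomConstants B hδ hκ hκ₁ hG hlo₁ hhi₁ hu₁ hlo₂ hhi₂ hu₂ hper₂ hν₂ φ θ
  have hs := abs_sin_normalAngle_sub_le_level B hδ hκ hκ₁ hG hlo₁ hhi₁ hu₁ hlo₂ hhi₂ hu₂ h₁ h₂ φ
  have hπ := Real.pi_pos
  have : π / 2 * |Real.sin ((φ - Real.arctan (deriv u₁ φ / u₁ φ)) - (φ - Real.arctan (deriv u₂ φ / u₂ φ)))| ≤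
      π * Kc * |ν₁ - ν₂| / (B.Dtmin - κ₁) ^ 2 := by
    calc _ ≤ π / 2 * (2 * Kc * |ν₁ - ν₂| / (B.Dtmin - κ₁) ^ 2) := mul_le_mul_of_nonneg_left hs (by positivity)
      _ = π * Kc * |ν₁ - ν₂| / (B.Dtmin - κ₁) ^ 2 := by ring
  linarith

end Frame

end Summit.HubbardSuperconductivity.HubbardSuperconductivity.Theorems.PerturbedFermiCurve

end
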